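import Summits.ValiantsHypothesis.ValiantsHypothesis.Theorems.KPlusLogSqLawWeakLiftingTowerGraftIsotropicLetters
import Summits.ValiantsHypothesis.ValiantsHypothesis.Theorems.LacunarySymmetroidMatrixDescartesDualWallCensus

/-!
# Tower graft line, `m = 2` row — ISOTROPIC SPLITTING: every symmetric `2 × 2` pencil with `K` letters IS an isotropic pencil with
# `2K` letters on the doubled support; the isotropic row at `2K` letters dominates the general row at `K` letters

Crux `stmt-ValiantsHypothesis-19561` (`Theses.KPlusLogSqLaw.WeakLifting`), line (B) `Cruxes/WeakLifting/Lines/tower_graft.lean`.  Companion (and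
honesty rider) of `…TowerGraftIsotropicLetters` (p821823: all letters singular ⇒ `Z₊ ≤ C(K,2) − 1`).

HONEST FRAMING.  An elementary REDUCTION inside the `m = 2` row; it proves nothing about `WeakLifting`, Conjecture B, the registered stubs,
`MatrixDescartes` (18050) or `VP ≠ VNP`.  Def-free helper.

* `exists_isotropic_add` — every real symmetric `2 × 2` matrix is the sum of TWO singular symmetric matrices (rational formulas, three cases:
  `S₀₀ ≠ 0`; `S₀₀ = 0 ≠ S₁₁`; `S₀₀ = S₁₁ = 0`; symmetry by the tree's `DualWallCensus.isSymm_two`);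
* `exists_isotropic_pencil_eq` — hence `∑_{l<K} X^{d_l} S_l = ∑_{j<2K} X^{(d ⧺ d)_j} T_j` with all `T_j` symmetric singular (`Fin.append`);
* **`posRootLawOn_of_isotropic_doubled`** — a bound `B` for all ISOTROPIC symmetric pencils with `2K` letters on the doubled support `d ⧺ d`
  gives `PosRootLawOn 2 K B d`.  READING: on supports with repeated exponents the isotropic row is the general row at half the letters, so a
  Descartes-beating cap for singular letters is NOT an easier sub-rung of the `m = 2` rung in general — only on INJECTIVE supports (e.g.
  2-towers, where `d ⧺ d` is excluded) is the isotropic row (`≤ C(K,2) − 1` monomials) a genuine restriction.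

[folklore] Elementary linear algebra.
-/

-- `Summit.ValiantsHypothesis.ValiantsHypothesis.…` repeats a component by the D-0017 layout
-- (single-conjunct summit), which the `dupNamespace` linter flags; the name is mandated.
set_option linter.dupNamespace false
set_option autoImplicit false

namespace Summit.ValiantsHypothesis.ValiantsHypothesis.Theorems.KPlusLogSqLaw.TowerGraft.IsotropicSplitting

open Polynomial Matrix Finset
open scoped BigOperators Polynomial Matrix
open Summit.ValiantsHypothesis.ValiantsHypothesis.Theorems.LacunarySymmetroidMatrixDescartes (PosRootLawOn)
open Summit.ValiantsHypothesis.ValiantsHypothesis.Theorems.LacunarySymmetroidMatrixDescartes.DualWallCensus (isSymm_two)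

variable {K : ℕ}

/-- **Isotropic splitting of one letter.**  Every real symmetric `2 × 2` matrix is a sum of two singular symmetric matrices. [folklore] -/
theorem exists_isotropic_add (S : Matrix (Fin 2) (Fin 2) ℝ) (hS : S.IsSymm) :
    ∃ T₁ T₂ : Matrix (Fin 2) (Fin 2) ℝ, T₁.IsSymm ∧ T₂.IsSymm ∧ T₁.det = 0 ∧ T₂.det = 0 ∧ T₁ + T₂ = S := by
  have h10 : S 1 0 = S 0 1 := hS.apply 0 1
  have hS' : S = !![S 0 0, S 0 1; S 0 1, S 1 1] := by
    ext i j
    fin_cases i <;> fin_cases j <;> simp [h10]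
  by_cases ha : S 0 0 ≠ 0
  · refine ⟨!![S 0 0, S 0 1; S 0 1, S 0 1 ^ 2 / S 0 0], !![0, 0; 0, S 1 1 - S 0 1 ^ 2 / S 0 0],
      isSymm_two _ _ _, isSymm_two _ _ _, ?_, ?_, ?_⟩
    · rw [Matrix.det_fin_two_of]; field_simp; ring
    · rw [Matrix.det_fin_two_of]; ring
    · conv_rhs => rw [hS']
      ext i j
      fin_cases i <;> fin_cases j <;> simp
  · rw [not_ne_iff] at ha
    by_cases hc : S 1 1 ≠ 0
    · refine ⟨!![S 0 1 ^ 2 / S 1 1, S 0 1; S 0 1, S 1 1], !![- (S 0 1 ^ 2 / S 1 1), 0; 0, 0],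
        isSymm_two _ _ _, isSymm_two _ _ _, ?_, ?_, ?_⟩
      · rw [Matrix.det_fin_two_of]; field_simp; ring
      · rw [Matrix.det_fin_two_of]; ring
      · conv_rhs => rw [hS']
        ext i j
        fin_cases i <;> fin_cases j <;> simp [ha]
    · rw [not_ne_iff] at hc
      refine ⟨!![S 0 1 / 2, S 0 1 / 2; S 0 1 / 2, S 0 1 / 2], !![- (S 0 1 / 2), S 0 1 / 2; S 0 1 / 2, - (S 0 1 / 2)],
        isSymm_two _ _ _, isSymm_two _ _ _, ?_, ?_, ?_⟩
      · rw [Matrix.det_fin_two_of]; ring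
      · rw [Matrix.det_fin_two_of]; ring
      · conv_rhs => rw [hS']
        ext i j
        fin_cases i <;> fin_cases j <;> simp [ha, hc]

/-- **The pencil is isotropic on the doubled support.**  `∑_{l<K} X^{d_l} S_l = ∑_{j<K+K} X^{(d ⧺ d)_j} T_j` with every `T_j` symmetric and
singular. [folklore] -/
theorem exists_isotropic_pencil_eq (d : Fin K → ℕ) (S : Fin K → Matrix (Fin 2) (Fin 2) ℝ) (hS : ∀ l, (S l).IsSymm) :
    ∃ T : Fin (K + K) → Matrix (Fin 2) (Fin 2) ℝ, (∀ j, (T j).IsSymm) ∧ (∀ j, (T j).det = 0) ∧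
      (∑ j, (X : ℝ[X]) ^ (Fin.append d d j) • (T j).map C) = ∑ l, (X : ℝ[X]) ^ d l • (S l).map C := by
  choose T₁ T₂ h₁ h₂ hd₁ hd₂ hsum using fun l => exists_isotropic_add (S l) (hS l)
  refine ⟨Fin.append T₁ T₂, ?_, ?_, ?_⟩
  · intro j
    refine Fin.addCases (fun l => ?_) (fun l => ?_) j
    · rw [Fin.append_left]; exact h₁ l
    · rw [Fin.append_right]; exact h₂ l
  · intro j
    refine Fin.addCases (fun l => ?_) (fun l => ?_) j
    · rw [Fin.append_left]; exact hd₁ l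
    · rw [Fin.append_right]; exact hd₂ l
  · rw [Fin.sum_univ_add]
    simp only [Fin.append_left, Fin.append_right]
    rw [← Finset.sum_add_distrib]
    refine Finset.sum_congr rfl fun l _ => ?_
    rw [← hsum l, Matrix.map_add C (fun a₁ a₂ => C_add), smul_add]

/-- **ISOTROPIC ROW AT `2K` LETTERS ⇒ GENERAL ROW AT `K` LETTERS.**  If every isotropic symmetric `2 × 2` pencil with `K + K` letters on
the doubled support `d ⧺ d` has at most `B` distinct positive roots of its determinant, then `PosRootLawOn 2 K B d`. [folklore] -/
theorem posRootLawOn_of_isotropic_doubled (B : ℕ) (d : Fin K → ℕ)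
    (h : ∀ T : Fin (K + K) → Matrix (Fin 2) (Fin 2) ℝ, (∀ j, (T j).IsSymm) → (∀ j, (T j).det = 0) →
      (((∑ j, (X : ℝ[X]) ^ (Fin.append d d j) • (T j).map C).det.roots.toFinset.filter (fun t => 0 < t)).card) ≤ B) :
    PosRootLawOn 2 K B d := by
  intro S hS
  obtain ⟨T, hT, hTd, heq⟩ := exists_isotropic_pencil_eq d S hS
  rw [← heq]
  exact h T hT hTd

/-- Sanity link with the companion file: the isotropic `K + K`-letter pencil obeys the letter-rank budget `C(K+K, 2) − 1`; for an
INJECTIVE support this is weaker than the row's Descartes ceiling `C(K+1,2) − 1`, as it must be (the doubled support has only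
`C(K+1, 2)` distinct pair sums). [folklore] -/
theorem isotropic_doubled_budget (d : Fin K → ℕ) (T : Fin (K + K) → Matrix (Fin 2) (Fin 2) ℝ) (hTd : ∀ j, (T j).det = 0) :
    (((∑ j, (X : ℝ[X]) ^ (Fin.append d d j) • (T j).map C).det.roots.toFinset.filter (fun t => 0 < t)).card) ≤
      (K + K).choose 2 - 1 :=
  IsotropicLetters.card_posRoots_le_of_isotropic (Fin.append d d) T hTd

end Summit.ValiantsHypothesis.ValiantsHypothesis.Theorems.KPlusLogSqLaw.TowerGraft.IsotropicSplitting
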